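import Literature.NumberTheory.Automorphic.DoubledUnitaryRankOneReductionRay
import Literature.NumberTheory.Automorphic.UnitaryGroupFormTransport
import HarnessLib

/-!
# Reduction theory for the Borel of `U(1,1)_{E/F}` in the DIAGONAL (doubled) model `U(T_W ⊕ −T_W)(𝔸_F)`

Topic `NumberTheory/Automorphic`; namespace `Literature.NumberTheory.Automorphic.DoubledUnitary.RankOneReduction`.
KERNEL ONLY (theorems; no definition, no named fact): Weil's Lemma 20 for the rank-one doubled unitary group
(★ `exists_borel_reduction_ray_mem`, split model `J₁ = !![0,1;1,0]`) TRANSPORTED to the carrier in which the doubled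
`W`-member of the unitary dual pair `(U(J_V), U(J_W ⊕ᶠ −J_W))` lives in the tree: the adelic points
`U_D := UnitaryGroup.adelic F E c (1+1) J_D` of the DIAGONAL hermitian matrix
`J_D := (reindex finSumFinEquiv finSumFinEquiv (fromBlocks T_W 0 0 (−T_W))).map (F → E)`, `T_W ∈ M₁(F)` non-zero
(so `J_D = !![t, 0; 0, −t]`, `t = T_W 0 0`), with BOREL the stabiliser of the diagonal isotropic line `W^Δ = E·(1,1)`:
`b₀₀ + b₀₁ = b₁₀ + b₁₁` (★ `UnitaryGroup.isSiegelReindex_finSumFinEquiv_iff_rowSum`).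

The CAYLEY change of basis `M = !![1, (2t)⁻¹; 1, −(2t)⁻¹]` (columns `ℓ = (1,1) ∈ W^Δ`, `ℓ* ∈ W^∇`, normalised so that
`h(ℓ, ℓ*) = 1`) satisfies `σ(M)ᵀ · diag(t, −t) · M = J₁`, so `g ↦ M g M⁻¹` carries `U(J₁)` onto `U_D`
(★ `conj_mem_unitaryGroupOfForm_iff`), upper-triangular elements onto the stabiliser of `W^Δ`, `E`-rational matrices to
`E`-rational matrices, and the ray `diag(z, z⁻¹)` to the Levi element `d(z) = ½·!![z + z⁻¹, z − z⁻¹; z − z⁻¹, z + z⁻¹]`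
(`z` on `ℓ`, `z̄⁻¹ = z⁻¹` on `ℓ*`).

* §1 (any commutative ring `S`, `h (t + t) = 1`): `formCongr_cayleyTwo` (`σ(M)ᵀ diag(t,−t) M = J₁`), `coe_inv_cayleyTwo`
  (`M⁻¹ = !![ht, ht; t, −t]`), `conj_apply_one_zero` (`(M⁻¹ b M)₁₀ = t·((b₀₀ + b₀₁) − (b₁₀ + b₁₁))` — Borel ↔ row sum),
  `coe_cayley_conj_glDiagonal` (`M diag(u,w) M⁻¹ = ht·!![u+w, u−w; u−w, u+w]`) and its row sums;
* §2 (`E/F`, adeles): `exists_cayleyTwo` — an `E`-RATIONAL `M ∈ GL₂(𝔸_E)` with that matrix; `adelicForm_doubledLine`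
  (`J_D` over `𝔸_E` is `!![t, 0; 0, −t]`); `conj_mem_adelic_doubledLine_iff` (`M g M⁻¹ ∈ U_D ↔ g ∈ U(J₁)`);
* §3 **`exists_borel_reduction_diag`** / **`exists_borel_reduction_diag_inv`**: for every threshold `r₁ > 0` there are such an `M`
  and a compact `C ⊆ U_D` with: every `b ∈ U_D` with `b₀₀ + b₀₁ = b₁₀ + b₁₁` satisfies `(M diag(z_E r, (z_E r)⁻¹) M⁻¹)⁻¹ · γ · b ∈ C`
  for some `E`-rational `γ ∈ U_D` and `r ≥ r₁` (resp. `diag((z_E r)⁻¹, z_E r)`, `r ≤ r₁`); `mem_range_toAdelic_iff` converts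
  «`γ ∈ U_D` and `γ` is an `E`-rational matrix» into `γ ∈ range (UnitaryGroup.toAdelic …)`.

References: A. Weil, *Sur la formule de Siegel dans la théorie des groupes classiques*, Acta Math. 113 (1965), n° 47 Lemme 20 (p. 67);
M. Harris, S. Kudla, W. Sweet, J. AMS 9 (1996), §1 (1.11) (the doubled space and `P_Δ`); A. Borel, Publ. IHES 16 (1963), §5.

Written for the Hodge-CM cell `pub/hodgecm-mathlib`, floor 0, crux H413 (stmt-HodgeConjecture-24833), E-2 child line
`F0_E2SiegelWeilWeilRange` (carrier `ratWToAut : UnitaryGroup.rational F E c (1+1) ((TWD F TW).map (algebraMap F E)) →* …`,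
`TWD F TW = reindex finSumFinEquiv finSumFinEquiv (fromBlocks TW 0 0 (−TW))`), row SW2c-BOUND (RED) (A-p16 (g18), 2026-08-31).
HC_CM is proved only modulo the printed citations until rung 0 closes; this file discharges none of them.
-/

noncomputable section

open NumberField IsDedekindDomain Matrix Set
open scoped MatrixGroups NNReal Pointwise

namespace Literature.NumberTheory.Automorphic.DoubledUnitary.RankOneReduction

/-! ## §1 The Cayley matrix `M = !![1, h; 1, −h]`, `h (t + t) = 1`, over a commutative ring -/

section Cayley

variable {S : Type*} [CommRing S] (τ : S →+* S) {M : GL (Fin 2) S} {t h : S}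

/-- **`σ(M)ᵀ · diag(t, −t) · M = J₁`** for `M = !![1, h; 1, −h]` with `h (t + t) = 1` and `τ h = h`: in the basis
`(ℓ, ℓ*) = ((1,1), h·(1,−1))` the doubled line `T ⊕ −T` is the split plane `!![0,1;1,0]`. [cite: HarrisKudlaSweet1996, §1 (1.11)] -/
theorem formCongr_cayleyTwo (hM : (M : Matrix (Fin 2) (Fin 2) S) = !![1, h; 1, -h]) (hτh : τ h = h)
    (hht : h * (t + t) = 1) :
    formCongr τ M !![t, 0; 0, -t] = !![0, 1; 1, 0] := by
  rw [formCongr, hM]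
  have hmap : (!![(1 : S), h; 1, -h] : Matrix (Fin 2) (Fin 2) S).map τ = !![1, h; 1, -h] := by
    ext i j
    fin_cases i <;> fin_cases j <;> simp [hτh]
  rw [hmap]
  ext i j
  fin_cases i <;> fin_cases j <;> simp [Matrix.mul_apply, Fin.sum_univ_two] <;> linear_combination hht

/-- `M · !![ht, ht; t, −t] = 1`. [cite: HarrisKudlaSweet1996, §1 (1.11)] -/
private theorem cayleyTwo_mul_inv (hM : (M : Matrix (Fin 2) (Fin 2) S) = !![1, h; 1, -h]) (hht : h * (t + t) = 1) :
    (M : Matrix (Fin 2) (Fin 2) S) * !![h * t, h * t; t, -t] = 1 := by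
  rw [hM]
  ext i j
  fin_cases i <;> fin_cases j <;> simp [Matrix.mul_apply, Fin.sum_univ_two] <;> linear_combination hht

/-- **`M⁻¹ = !![ht, ht; t, −t]`** (`ht = ½`). [cite: HarrisKudlaSweet1996, §1 (1.11)] -/
theorem coe_inv_cayleyTwo (hM : (M : Matrix (Fin 2) (Fin 2) S) = !![1, h; 1, -h]) (hht : h * (t + t) = 1) :
    ((M⁻¹ : GL (Fin 2) S) : Matrix (Fin 2) (Fin 2) S) = !![h * t, h * t; t, -t] :=
  Units.inv_eq_of_mul_eq_one_right (cayleyTwo_mul_inv hM hht)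

/-- **Borel ↔ row sum**: `(M⁻¹ b M)₁₀ = t · ((b₀₀ + b₀₁) − (b₁₀ + b₁₁))` — `M⁻¹ b M` is upper-triangular iff `b` stabilises the
line `E·(1,1) = W^Δ` (for `t` a unit). [cite: HarrisKudlaSweet1996, §1 (1.11)] -/
theorem conj_apply_one_zero (hM : (M : Matrix (Fin 2) (Fin 2) S) = !![1, h; 1, -h]) (hht : h * (t + t) = 1)
    (b : GL (Fin 2) S) :
    ((M⁻¹ * b * M : GL (Fin 2) S) : Matrix (Fin 2) (Fin 2) S) 1 0 =
      t * (((b : Matrix (Fin 2) (Fin 2) S) 0 0 + (b : Matrix (Fin 2) (Fin 2) S) 0 1) -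
        ((b : Matrix (Fin 2) (Fin 2) S) 1 0 + (b : Matrix (Fin 2) (Fin 2) S) 1 1)) := by
  rw [Units.val_mul, Units.val_mul, coe_inv_cayleyTwo hM hht, hM]
  simp [Matrix.mul_apply, Fin.sum_univ_two, Matrix.vecMul, dotProduct]
  ring

/-- The matrix of `glDiagonal 2 S ![u, w]` is `!![u, 0; 0, w]`. [folklore] -/
private theorem coe_glDiagonal_two' (u w : Sˣ) :
    ((glDiagonal 2 S ![u, w] : GL (Fin 2) S) : Matrix (Fin 2) (Fin 2) S) = !![(u : S), 0; 0, (w : S)] := by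
  rw [coe_glDiagonal]
  ext i j
  fin_cases i <;> fin_cases j <;> simp

/-- **The Levi element in the diagonal model**: `M · diag(u, w) · M⁻¹ = ht · !![u + w, u − w; u − w, u + w]`.
[cite: HarrisKudlaSweet1996, §1 (1.11)] -/
theorem coe_cayley_conj_glDiagonal (hM : (M : Matrix (Fin 2) (Fin 2) S) = !![1, h; 1, -h]) (hht : h * (t + t) = 1)
    (u w : Sˣ) :
    ((M * glDiagonal 2 S ![u, w] * M⁻¹ : GL (Fin 2) S) : Matrix (Fin 2) (Fin 2) S) =
      !![h * t * (u + w), h * t * (u - w); h * t * (u - w), h * t * (u + w)] := by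
  rw [Units.val_mul, Units.val_mul, coe_inv_cayleyTwo hM hht, hM, coe_glDiagonal_two']
  ext i j
  fin_cases i <;> fin_cases j <;> simp [Matrix.mul_apply, Fin.sum_univ_two] <;> ring

/-- The Levi element `M · diag(u, w) · M⁻¹` stabilises `W^Δ`: its two row sums agree (both equal `u`).
[cite: HarrisKudlaSweet1996, §1 (1.11)] -/
theorem rowSum_cayley_conj_glDiagonal (hM : (M : Matrix (Fin 2) (Fin 2) S) = !![1, h; 1, -h]) (hht : h * (t + t) = 1)
    (u w : Sˣ) :
    ((M * glDiagonal 2 S ![u, w] * M⁻¹ : GL (Fin 2) S) : Matrix (Fin 2) (Fin 2) S) 0 0 +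
        ((M * glDiagonal 2 S ![u, w] * M⁻¹ : GL (Fin 2) S) : Matrix (Fin 2) (Fin 2) S) 0 1 =
      ((M * glDiagonal 2 S ![u, w] * M⁻¹ : GL (Fin 2) S) : Matrix (Fin 2) (Fin 2) S) 1 0 +
        ((M * glDiagonal 2 S ![u, w] * M⁻¹ : GL (Fin 2) S) : Matrix (Fin 2) (Fin 2) S) 1 1 := by
  rw [coe_cayley_conj_glDiagonal hM hht]
  simp
  ring

/-- Upper-triangular after conjugation ⇒ row sums agree: if `(M⁻¹ b M)₁₀ = 0`-shape holds in the form `b = M b' M⁻¹` with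
`b'₁₀ = 0`, then `b₀₀ + b₀₁ = b₁₀ + b₁₁`. [cite: HarrisKudlaSweet1996, §1 (1.11)] -/
theorem rowSum_cayley_conj_of_apply_one_zero (hM : (M : Matrix (Fin 2) (Fin 2) S) = !![1, h; 1, -h])
    (hht : h * (t + t) = 1) {b' : GL (Fin 2) S} (hb' : (b' : Matrix (Fin 2) (Fin 2) S) 1 0 = 0) :
    ((M * b' * M⁻¹ : GL (Fin 2) S) : Matrix (Fin 2) (Fin 2) S) 0 0 +
        ((M * b' * M⁻¹ : GL (Fin 2) S) : Matrix (Fin 2) (Fin 2) S) 0 1 =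
      ((M * b' * M⁻¹ : GL (Fin 2) S) : Matrix (Fin 2) (Fin 2) S) 1 0 +
        ((M * b' * M⁻¹ : GL (Fin 2) S) : Matrix (Fin 2) (Fin 2) S) 1 1 := by
  rw [Units.val_mul, Units.val_mul, coe_inv_cayleyTwo hM hht, hM]
  simp [Matrix.mul_apply, Fin.sum_univ_two, Matrix.vecMul, dotProduct, hb']
  ring

end Cayley

/-! ## §2 The quadratic extension `E/F`: the rational Cayley matrix over `𝔸_E` and the doubled line `!![t, 0; 0, −t]` -/

section Adelic

variable (F E : Type) [Field F] [NumberField F] [Field E] [NumberField E] [Algebra F E] (c : E ≃ₐ[F] E)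
  (TW : Matrix (Fin 1) (Fin 1) F)

/-- **The doubled line over `𝔸_E` is `!![t, 0; 0, −t]`**, `t = T_W 0 0`: the tree's
`adelicForm E (1+1) ((reindex finSumFinEquiv finSumFinEquiv (fromBlocks T_W 0 0 (−T_W))).map (F → E))` spelled out.
[cite: HarrisKudlaSweet1996, §1 (1.11)] -/
theorem adelicForm_doubledLine :
    UnitaryGroup.adelicForm E (1 + 1)
        ((Matrix.reindex finSumFinEquiv finSumFinEquiv (Matrix.fromBlocks TW 0 0 (-TW))).map (algebraMap F E)) =
      !![algebraMap E (AdeleRing (𝓞 E) E) (algebraMap F E (TW 0 0)), 0;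
        0, -algebraMap E (AdeleRing (𝓞 E) E) (algebraMap F E (TW 0 0))] := by
  unfold UnitaryGroup.adelicForm
  ext i j
  have h0 : ((finSumFinEquiv : Fin 1 ⊕ Fin 1 ≃ Fin (1 + 1)).symm 0) = Sum.inl 0 := rfl
  have h1 : ((finSumFinEquiv : Fin 1 ⊕ Fin 1 ≃ Fin (1 + 1)).symm 1) = Sum.inr 0 := rfl
  fin_cases i <;> fin_cases j <;>
    simp [Matrix.reindex_apply, Matrix.submatrix_apply, h0, h1, Matrix.fromBlocks_apply₁₁, Matrix.fromBlocks_apply₁₂,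
      Matrix.fromBlocks_apply₂₁, Matrix.fromBlocks_apply₂₂]

/-- **An `E`-rational Cayley matrix over `𝔸_E`**: for `t = T_W 0 0 ≠ 0` there is `M ∈ GL₂(𝔸_E)`, the image of an
`E`-rational (indeed `F`-rational) invertible matrix, with `M = !![1, h; 1, −h]`, `h = (2t)⁻¹` (so `h (t + t) = 1` and `c̄ h = h`).
Stated as an existence so that no definition is introduced. [cite: HarrisKudlaSweet1996, §1 (1.11)] -/
theorem exists_cayleyTwo (hTW : TW 0 0 ≠ 0) :
    ∃ M : GL (Fin 2) (AdeleRing (𝓞 E) E),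
      M ∈ (Matrix.GeneralLinearGroup.map (algebraMap E (AdeleRing (𝓞 E) E))).range ∧
      (M : Matrix (Fin 2) (Fin 2) (AdeleRing (𝓞 E) E)) =
        !![1, algebraMap E (AdeleRing (𝓞 E) E) (algebraMap F E (2 * TW 0 0)⁻¹);
          1, -algebraMap E (AdeleRing (𝓞 E) E) (algebraMap F E (2 * TW 0 0)⁻¹)] := by
  set hE : E := algebraMap F E (2 * TW 0 0)⁻¹ with hhE
  have h2t : (2 * TW 0 0) ≠ 0 := mul_ne_zero two_ne_zero hTW
  have hdet : (!![(1 : E), hE; 1, -hE] : Matrix (Fin 2) (Fin 2) E).det ≠ 0 := by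
    rw [Matrix.det_fin_two_of]
    have hne : hE ≠ 0 := by
      rw [hhE]
      exact (map_ne_zero (algebraMap F E)).2 (inv_ne_zero h2t)
    intro h
    have h2 : (2 : E) * hE = 0 := by linear_combination -h
    exact hne ((mul_eq_zero.1 h2).resolve_left two_ne_zero)
  refine ⟨Matrix.GeneralLinearGroup.map (algebraMap E (AdeleRing (𝓞 E) E))
      (Matrix.GeneralLinearGroup.mkOfDetNeZero _ hdet), ⟨_, rfl⟩, ?_⟩
  change (!![(1 : E), hE; 1, -hE] : Matrix (Fin 2) (Fin 2) E).map (algebraMap E (AdeleRing (𝓞 E) E)) = _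
  ext i j
  fin_cases i <;> fin_cases j <;> simp

/-- `h (t + t) = 1` for `h = (2t)⁻¹`, read in `𝔸_E`. [folklore] -/
private theorem cayleyTwo_entry_mul (hTW : TW 0 0 ≠ 0) :
    algebraMap E (AdeleRing (𝓞 E) E) (algebraMap F E (2 * TW 0 0)⁻¹) *
        (algebraMap E (AdeleRing (𝓞 E) E) (algebraMap F E (TW 0 0)) +
          algebraMap E (AdeleRing (𝓞 E) E) (algebraMap F E (TW 0 0))) = 1 := by
  rw [← map_add, ← map_add, ← map_mul, ← map_mul, ← two_mul, inv_mul_cancel₀ (mul_ne_zero two_ne_zero hTW), map_one,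
    map_one]

omit [NumberField F] in
/-- `c ⊗ 1` fixes the `F`-rational adele `ι(x)`, `x ∈ F`. [folklore] -/
private theorem conjAdele_algebraMap_algebraMap (x : F) :
    UnitaryGroup.conjAdele F E c (algebraMap E (AdeleRing (𝓞 E) E) (algebraMap F E x)) =
      algebraMap E (AdeleRing (𝓞 E) E) (algebraMap F E x) := by
  rw [← UnitaryGroup.algebraMap_conj F E c]
  exact congrArg (algebraMap E (AdeleRing (𝓞 E) E)) (c.commutes x)

/-- **Transport of membership**: for the Cayley matrix `M`, `M g M⁻¹ ∈ U_D = U(c ⊗ 1, T_W ⊕ −T_W)(𝔸_F)` iff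
`g ∈ U(c ⊗ 1, J₁)`. [cite: HarrisKudlaSweet1996, §1 (1.11)] -/
theorem conj_mem_adelic_doubledLine_iff (hTW : TW 0 0 ≠ 0) {M : GL (Fin 2) (AdeleRing (𝓞 E) E)}
    (hM : (M : Matrix (Fin 2) (Fin 2) (AdeleRing (𝓞 E) E)) =
      !![1, algebraMap E (AdeleRing (𝓞 E) E) (algebraMap F E (2 * TW 0 0)⁻¹);
        1, -algebraMap E (AdeleRing (𝓞 E) E) (algebraMap F E (2 * TW 0 0)⁻¹)])
    (g : GL (Fin 2) (AdeleRing (𝓞 E) E)) :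
    M * g * M⁻¹ ∈ UnitaryGroup.adelic F E c (1 + 1)
        ((Matrix.reindex finSumFinEquiv finSumFinEquiv (Matrix.fromBlocks TW 0 0 (-TW))).map (algebraMap F E)) ↔
      g ∈ unitaryGroupOfForm (UnitaryGroup.conjAdele F E c)
        (!![(0 : AdeleRing (𝓞 E) E), 1; 1, 0] : Matrix (Fin 2) (Fin 2) (AdeleRing (𝓞 E) E)) := by
  unfold UnitaryGroup.adelic
  rw [adelicForm_doubledLine, conj_mem_unitaryGroupOfForm_iff,
    formCongr_cayleyTwo (UnitaryGroup.conjAdele F E c) hM (conjAdele_algebraMap_algebraMap F E c _)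
      (cayleyTwo_entry_mul F E TW hTW)]

omit [NumberField F] in
/-- **`E`-rational points**: an element of `U_D(𝔸_F) = UnitaryGroup.adelic …` lies in the range of
`UnitaryGroup.toAdelic` iff its matrix is `E`-rational (injectivity of `E → 𝔸_E`). [cite: Mok2014, §1 Notation p. 5] -/
theorem mem_range_toAdelic_iff {N : ℕ} (J : Matrix (Fin N) (Fin N) E) (x : UnitaryGroup.adelic F E c N J) :
    x ∈ (UnitaryGroup.toAdelic F E c N J).range ↔
      (x : GL (Fin N) (AdeleRing (𝓞 E) E)) ∈ (Matrix.GeneralLinearGroup.map (algebraMap E (AdeleRing (𝓞 E) E))).range := by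
  constructor
  · rintro ⟨g, rfl⟩
    exact ⟨(g : GL (Fin N) E), rfl⟩
  · rintro ⟨g, hg⟩
    have hinj : Function.Injective (algebraMap E (AdeleRing (𝓞 E) E)) := AdeleRing.algebraMap_injective (𝓞 E) E
    have hgmem : g ∈ UnitaryGroup.rational F E c N J := by
      have hx := x.2
      unfold UnitaryGroup.adelic UnitaryGroup.adelicForm at hx
      rw [mem_unitaryGroupOfForm_iff, ← hg] at hx
      unfold UnitaryGroup.rational
      rw [mem_unitaryGroupOfForm_iff]
      have key : ∀ y : E, UnitaryGroup.conjAdele F E c (algebraMap E (AdeleRing (𝓞 E) E) y) =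
          algebraMap E (AdeleRing (𝓞 E) E) ((c : E →+* E) y) := fun y => (UnitaryGroup.algebraMap_conj F E c y).symm
      have hg' : ((Matrix.GeneralLinearGroup.map (algebraMap E (AdeleRing (𝓞 E) E)) g : GL (Fin N) (AdeleRing (𝓞 E) E)) :
          Matrix (Fin N) (Fin N) (AdeleRing (𝓞 E) E)) = (g : Matrix (Fin N) (Fin N) E).map (algebraMap E (AdeleRing (𝓞 E) E)) := rfl
      rw [hg', Matrix.map_map] at hx
      have hx' : (((g : Matrix (Fin N) (Fin N) E).map (c : E →+* E))ᵀ * J * (g : Matrix (Fin N) (Fin N) E)).map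
          (algebraMap E (AdeleRing (𝓞 E) E)) = J.map (algebraMap E (AdeleRing (𝓞 E) E)) := by
        rw [Matrix.map_mul, Matrix.map_mul, Matrix.transpose_map, Matrix.map_map]
        have hcomp : (algebraMap E (AdeleRing (𝓞 E) E)) ∘ (c : E →+* E) =
            UnitaryGroup.conjAdele F E c ∘ algebraMap E (AdeleRing (𝓞 E) E) := funext fun y => (key y).symm
        rw [hcomp]
        exact hx
      exact Matrix.map_injective hinj hx'
    exact ⟨⟨g, hgmem⟩, Subtype.ext hg⟩

end Adelic

/-! ## §3 The reduction theorem in the diagonal model -/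

section Main

variable (F E : Type) [Field F] [NumberField F] [Field E] [NumberField E] [Algebra F E] (c : E ≃ₐ[F] E)
  (TW : Matrix (Fin 1) (Fin 1) F)

/-- **Reduction theory for the Borel of `U(1,1)_{E/F}` in the DIAGONAL (doubled) model, membership form, cusp side `r₀ ≤ r`.**
`E/F` quadratic with `Gal(E/F) = {1, c}`, `δ ∈ Eˣ` with `c δ = −δ`, `T_W ∈ M₁(F)` with `t = T_W 0 0 ≠ 0`,
`U_D = UnitaryGroup.adelic F E c (1+1) (T_W ⊕ −T_W)`, and ANY threshold `r₁ > 0`.  There are the `E`-rational Cayley matrix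
`M = !![1, (2t)⁻¹; 1, −(2t)⁻¹]` and a COMPACT `C ⊆ U_D` such that every `b ∈ U_D` stabilising `W^Δ` (`b₀₀ + b₀₁ = b₁₀ + b₁₁`) satisfies
`(M · diag(z_E r, (z_E r)⁻¹) · M⁻¹)⁻¹ · γ · b ∈ C` for some `E`-rational `γ ∈ U_D` and some `r ≥ r₁`
(Weil (1965) n° 47 Lemme 20 for the rank-one doubled unitary group, transported from ★ `exists_borel_reduction_ray_mem_ge` along `M`).
[cite: Weil1965, n° 47 Lemme 20 (p. 67)] -/
theorem exists_borel_reduction_diag [IsGalois F E] (h2 : ∀ σ : E ≃ₐ[F] E, σ = 1 ∨ σ = c) (δ : Eˣ)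
    (hcδ : c (δ : E) = -(δ : E)) (hTW : TW 0 0 ≠ 0) (r₁ : ℝ≥0ˣ) :
    ∃ M : GL (Fin 2) (AdeleRing (𝓞 E) E),
      M ∈ (Matrix.GeneralLinearGroup.map (algebraMap E (AdeleRing (𝓞 E) E))).range ∧
      (M : Matrix (Fin 2) (Fin 2) (AdeleRing (𝓞 E) E)) =
        !![1, algebraMap E (AdeleRing (𝓞 E) E) (algebraMap F E (2 * TW 0 0)⁻¹);
          1, -algebraMap E (AdeleRing (𝓞 E) E) (algebraMap F E (2 * TW 0 0)⁻¹)] ∧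
      ∃ C : Set (GL (Fin (1 + 1)) (AdeleRing (𝓞 E) E)), IsCompact C ∧
        C ⊆ UnitaryGroup.adelic F E c (1 + 1)
            ((Matrix.reindex finSumFinEquiv finSumFinEquiv (Matrix.fromBlocks TW 0 0 (-TW))).map (algebraMap F E)) ∧
        ∀ b : GL (Fin (1 + 1)) (AdeleRing (𝓞 E) E),
          b ∈ UnitaryGroup.adelic F E c (1 + 1)
              ((Matrix.reindex finSumFinEquiv finSumFinEquiv (Matrix.fromBlocks TW 0 0 (-TW))).map (algebraMap F E)) →
          (b : Matrix (Fin (1 + 1)) (Fin (1 + 1)) (AdeleRing (𝓞 E) E)) 0 0 +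
              (b : Matrix (Fin (1 + 1)) (Fin (1 + 1)) (AdeleRing (𝓞 E) E)) 0 1 =
            (b : Matrix (Fin (1 + 1)) (Fin (1 + 1)) (AdeleRing (𝓞 E) E)) 1 0 +
              (b : Matrix (Fin (1 + 1)) (Fin (1 + 1)) (AdeleRing (𝓞 E) E)) 1 1 →
          ∃ γ ∈ UnitaryGroup.adelic F E c (1 + 1)
              ((Matrix.reindex finSumFinEquiv finSumFinEquiv (Matrix.fromBlocks TW 0 0 (-TW))).map (algebraMap F E)),
            γ ∈ (Matrix.GeneralLinearGroup.map (algebraMap E (AdeleRing (𝓞 E) E))).range ∧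
            ∃ r : ℝ≥0ˣ, r₁ ≤ r ∧
              (M * glDiagonal 2 (AdeleRing (𝓞 E) E) ![posRealIdele E r, (posRealIdele E r)⁻¹] * M⁻¹)⁻¹ * γ * b ∈ C := by
  obtain ⟨M, hMrat, hM⟩ := exists_cayleyTwo F E TW hTW
  obtain ⟨C, hCc, hCU, hred⟩ := exists_borel_reduction_ray_mem_ge F E c h2 δ hcδ r₁
  have hht := cayleyTwo_entry_mul F E TW hTW
  have hiff := fun g => conj_mem_adelic_doubledLine_iff F E c TW hTW hM g
  refine ⟨M, hMrat, hM, (fun k => M * k * M⁻¹) '' C, hCc.image ((continuous_const.mul continuous_id).mul continuous_const),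
    ?_, fun b hb hrow => ?_⟩
  · rintro _ ⟨k, hk, rfl⟩
    exact (hiff k).2 (hCU hk)
  -- transport `b` to the split model
  set b' : GL (Fin 2) (AdeleRing (𝓞 E) E) := M⁻¹ * b * M with hb'
  have hbb' : M * b' * M⁻¹ = b := by rw [hb']; group
  have hb'U : b' ∈ unitaryGroupOfForm (UnitaryGroup.conjAdele F E c)
      (!![(0 : AdeleRing (𝓞 E) E), 1; 1, 0] : Matrix (Fin 2) (Fin 2) (AdeleRing (𝓞 E) E)) := by
    rw [← hiff b', hbb']
    exact hb
  have hb'10 : (b' : Matrix (Fin 2) (Fin 2) (AdeleRing (𝓞 E) E)) 1 0 = 0 := by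
    rw [hb', conj_apply_one_zero hM hht b]
    have hrow' : ((b : Matrix (Fin 2) (Fin 2) (AdeleRing (𝓞 E) E)) 0 0 + (b : Matrix (Fin 2) (Fin 2) (AdeleRing (𝓞 E) E)) 0 1) -
        ((b : Matrix (Fin 2) (Fin 2) (AdeleRing (𝓞 E) E)) 1 0 + (b : Matrix (Fin 2) (Fin 2) (AdeleRing (𝓞 E) E)) 1 1) = 0 :=
      sub_eq_zero.2 hrow
    rw [hrow', mul_zero]
  obtain ⟨γ', hγ'U, hγ'rat, r, hr, hmem⟩ := hred b' hb'U hb'10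
  refine ⟨M * γ' * M⁻¹, (hiff γ').2 hγ'U, ?_, r, hr, ?_⟩
  · exact mul_mem (mul_mem hMrat hγ'rat) (inv_mem hMrat)
  · refine ⟨_, hmem, ?_⟩
    -- `M (D⁻¹ γ' b') M⁻¹ = (M D M⁻¹)⁻¹ (M γ' M⁻¹) b`
    rw [← hbb']
    group

/-- **Reduction theory in the diagonal model, parametrisation `r ≤ r₁`** (ray point `M · diag((z_E r)⁻¹, z_E r) · M⁻¹`; any `r₁ > 0`).
[cite: Weil1965, n° 47 Lemme 20 (p. 67)] -/
theorem exists_borel_reduction_diag_inv [IsGalois F E] (h2 : ∀ σ : E ≃ₐ[F] E, σ = 1 ∨ σ = c) (δ : Eˣ)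
    (hcδ : c (δ : E) = -(δ : E)) (hTW : TW 0 0 ≠ 0) (r₁ : ℝ≥0ˣ) :
    ∃ M : GL (Fin 2) (AdeleRing (𝓞 E) E),
      M ∈ (Matrix.GeneralLinearGroup.map (algebraMap E (AdeleRing (𝓞 E) E))).range ∧
      (M : Matrix (Fin 2) (Fin 2) (AdeleRing (𝓞 E) E)) =
        !![1, algebraMap E (AdeleRing (𝓞 E) E) (algebraMap F E (2 * TW 0 0)⁻¹);
          1, -algebraMap E (AdeleRing (𝓞 E) E) (algebraMap F E (2 * TW 0 0)⁻¹)] ∧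
      ∃ C : Set (GL (Fin (1 + 1)) (AdeleRing (𝓞 E) E)), IsCompact C ∧
        C ⊆ UnitaryGroup.adelic F E c (1 + 1)
            ((Matrix.reindex finSumFinEquiv finSumFinEquiv (Matrix.fromBlocks TW 0 0 (-TW))).map (algebraMap F E)) ∧
        ∀ b : GL (Fin (1 + 1)) (AdeleRing (𝓞 E) E),
          b ∈ UnitaryGroup.adelic F E c (1 + 1)
              ((Matrix.reindex finSumFinEquiv finSumFinEquiv (Matrix.fromBlocks TW 0 0 (-TW))).map (algebraMap F E)) →
          (b : Matrix (Fin (1 + 1)) (Fin (1 + 1)) (AdeleRing (𝓞 E) E)) 0 0 +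
              (b : Matrix (Fin (1 + 1)) (Fin (1 + 1)) (AdeleRing (𝓞 E) E)) 0 1 =
            (b : Matrix (Fin (1 + 1)) (Fin (1 + 1)) (AdeleRing (𝓞 E) E)) 1 0 +
              (b : Matrix (Fin (1 + 1)) (Fin (1 + 1)) (AdeleRing (𝓞 E) E)) 1 1 →
          ∃ γ ∈ UnitaryGroup.adelic F E c (1 + 1)
              ((Matrix.reindex finSumFinEquiv finSumFinEquiv (Matrix.fromBlocks TW 0 0 (-TW))).map (algebraMap F E)),
            γ ∈ (Matrix.GeneralLinearGroup.map (algebraMap E (AdeleRing (𝓞 E) E))).range ∧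
            ∃ r : ℝ≥0ˣ, r ≤ r₁ ∧
              (M * glDiagonal 2 (AdeleRing (𝓞 E) E) ![(posRealIdele E r)⁻¹, posRealIdele E r] * M⁻¹)⁻¹ * γ * b ∈ C := by
  obtain ⟨M, hMrat, hM, C, hCc, hCU, hred⟩ := exists_borel_reduction_diag F E c TW h2 δ hcδ hTW r₁⁻¹
  refine ⟨M, hMrat, hM, C, hCc, hCU, fun b hb hrow => ?_⟩
  obtain ⟨γ, hγU, hγrat, r, hr, hmem⟩ := hred b hb hrow
  refine ⟨γ, hγU, hγrat, r⁻¹, inv_le_of_inv_le' hr, ?_⟩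
  rw [map_inv, inv_inv]
  exact hmem

/-- **The ray point of the diagonal model spelled out**: for the Cayley matrix `M` and units `u, w`,
`M · diag(u, w) · M⁻¹ = ½ · !![u + w, u − w; u − w, u + w]` over `𝔸_E`. [cite: HarrisKudlaSweet1996, §1 (1.11)] -/
theorem coe_cayley_conj_glDiagonal_adelic (hTW : TW 0 0 ≠ 0) {M : GL (Fin 2) (AdeleRing (𝓞 E) E)}
    (hM : (M : Matrix (Fin 2) (Fin 2) (AdeleRing (𝓞 E) E)) =
      !![1, algebraMap E (AdeleRing (𝓞 E) E) (algebraMap F E (2 * TW 0 0)⁻¹);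
        1, -algebraMap E (AdeleRing (𝓞 E) E) (algebraMap F E (2 * TW 0 0)⁻¹)])
    (u w : (AdeleRing (𝓞 E) E)ˣ) :
    ((M * glDiagonal 2 (AdeleRing (𝓞 E) E) ![u, w] * M⁻¹ : GL (Fin 2) (AdeleRing (𝓞 E) E)) :
        Matrix (Fin 2) (Fin 2) (AdeleRing (𝓞 E) E)) =
      !![algebraMap E (AdeleRing (𝓞 E) E) 2⁻¹ * (u + w), algebraMap E (AdeleRing (𝓞 E) E) 2⁻¹ * (u - w);
        algebraMap E (AdeleRing (𝓞 E) E) 2⁻¹ * (u - w), algebraMap E (AdeleRing (𝓞 E) E) 2⁻¹ * (u + w)] := by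
  have hhalf : algebraMap E (AdeleRing (𝓞 E) E) (algebraMap F E (2 * TW 0 0)⁻¹) *
      algebraMap E (AdeleRing (𝓞 E) E) (algebraMap F E (TW 0 0)) = algebraMap E (AdeleRing (𝓞 E) E) 2⁻¹ := by
    have hF : (2 * TW 0 0)⁻¹ * TW 0 0 = (2 : F)⁻¹ := by field_simp
    rw [← map_mul, ← map_mul, hF, map_inv₀, map_ofNat]
  rw [coe_cayley_conj_glDiagonal hM (cayleyTwo_entry_mul F E TW hTW), hhalf]

/-- **The Levi element `d(u) = M · diag(u, (c̄u)⁻¹) · M⁻¹` lies in `U_D`** (`u ∈ 𝔸_E^×`; image of ★ `diag_mem_unitaryGroupOfForm`).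
[cite: GelbartRogawski1991, §1] -/
theorem cayley_conj_diag_mem_adelic (h2 : ∀ σ : E ≃ₐ[F] E, σ = 1 ∨ σ = c) (hTW : TW 0 0 ≠ 0)
    {M : GL (Fin 2) (AdeleRing (𝓞 E) E)}
    (hM : (M : Matrix (Fin 2) (Fin 2) (AdeleRing (𝓞 E) E)) =
      !![1, algebraMap E (AdeleRing (𝓞 E) E) (algebraMap F E (2 * TW 0 0)⁻¹);
        1, -algebraMap E (AdeleRing (𝓞 E) E) (algebraMap F E (2 * TW 0 0)⁻¹)])
    (u : (AdeleRing (𝓞 E) E)ˣ) :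
    M * glDiagonal 2 (AdeleRing (𝓞 E) E)
          ![u, (Units.map (UnitaryGroup.conjAdele F E c : AdeleRing (𝓞 E) E →* AdeleRing (𝓞 E) E) u)⁻¹] * M⁻¹ ∈
      UnitaryGroup.adelic F E c (1 + 1)
        ((Matrix.reindex finSumFinEquiv finSumFinEquiv (Matrix.fromBlocks TW 0 0 (-TW))).map (algebraMap F E)) :=
  (conj_mem_adelic_doubledLine_iff F E c TW hTW hM _).2
    (diag_mem_unitaryGroupOfForm (UnitaryGroup.conjAdele F E c) (conjAdele_conjAdele F E c h2) u)

/-- **The real ray `M · diag(z_E r, (z_E r)⁻¹) · M⁻¹` lies in `U_D`.** [cite: GelbartRogawski1991, §1] -/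
theorem cayley_conj_diag_posRealIdele_mem_adelic (hTW : TW 0 0 ≠ 0) {M : GL (Fin 2) (AdeleRing (𝓞 E) E)}
    (hM : (M : Matrix (Fin 2) (Fin 2) (AdeleRing (𝓞 E) E)) =
      !![1, algebraMap E (AdeleRing (𝓞 E) E) (algebraMap F E (2 * TW 0 0)⁻¹);
        1, -algebraMap E (AdeleRing (𝓞 E) E) (algebraMap F E (2 * TW 0 0)⁻¹)])
    (r : ℝ≥0ˣ) :
    M * glDiagonal 2 (AdeleRing (𝓞 E) E) ![posRealIdele E r, (posRealIdele E r)⁻¹] * M⁻¹ ∈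
      UnitaryGroup.adelic F E c (1 + 1)
        ((Matrix.reindex finSumFinEquiv finSumFinEquiv (Matrix.fromBlocks TW 0 0 (-TW))).map (algebraMap F E)) :=
  (conj_mem_adelic_doubledLine_iff F E c TW hTW hM _).2 (diag_posRealIdele_mem_unitaryGroupOfForm F E c r)

end Main

end Literature.NumberTheory.Automorphic.DoubledUnitary.RankOneReduction

end
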